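import Summits.BirchSwinnertonDyer.BirchSwinnertonDyer.Theses.LeadingTerm

/-!
# Route LeadingTerm — support item `LBOfCruxes` (stmt-BirchSwinnertonDyer-15623)

`LBOfCruxes := Consistency → PinchPrime → ∀ W elliptic, iteratedDeriv (rank_ℤ W(ℚ)) L_W 1 ≠ 0` is the
archimedean lower bound `LB_∞` of the route: the two cruxes at ONE good ordinary pinch prime force the
RANK-INDEXED Taylor coefficient `L^(r_MW)(E,1)` to be non-zero. It is the first half of the route's
certified deciding theorem `Summit.BirchSwinnertonDyer.BirchSwinnertonDyer.Theses.LeadingTerm.closes`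
(route file rev 6); this file extracts that half as a free-standing theorem, with the transport and
non-vanishing steps split into named helper lemmas:

* `leadingTerm_mordellWeilRank_smul` — the Mordell–Weil rank is invariant under a variable change
  (AEC III.3.1(b); `VariableChange.finrank_point_variableChange`);
* `leadingTerm_localEulerFactor_smul`, `leadingTerm_entireLFunction_smul` — the local Euler factors
  (read off minimal models over each `ℤ_[p]`), hence the entire L-function, are invariant under a
  variable change;
* `leadingTerm_padicLog_cyclotomicGenerator_ne_zero` — `log_p γ_cyc ≠ 0` (the Iwasawa logarithm
  vanishes exactly on `p^ℤ · μ`, `padicLog_eq_zero_iff_holds`, and `γ_cyc = 1 + p^e ≥ 2` is prime to `p`);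
* `leadingTerm_iteratedDeriv_ne_zero_of_isGloballyMinimal` — on a globally minimal model: the pinch
  prime `p`, its canonical cyclotomic height datum `D` and the newform `f` come from `PinchPrime`;
  `ord_T L_p = r_MW` makes `[T^{r_MW}] L_p ≠ 0` (`PowerSeries.order_eq_nat`), so the rational `q` of
  `Consistency` is non-zero, and with `Ω⁺_f > 0`, `Reg_∞ > 0` (the well-definedness conjuncts of
  `Consistency`) the archimedean side `r! · q · Ω⁺_f · Reg_∞` is non-zero;
* `leadingTerm_lbOfCruxes_proof` — pass to a global minimal model `C • W`
  (`hasGlobalMinimalModel_rat_holds`) and transport back along `C`.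

No modularity and no unproved Literature fact is a hypothesis; the only import is the route file, so
the module cone is the route's own (rev 5/6 cone repair).
-/

namespace Summit.BirchSwinnertonDyer.BirchSwinnertonDyer.Theorems

open Literature
open Summit.BirchSwinnertonDyer.BirchSwinnertonDyer.Theses.LeadingTerm

/-- (T1) The Mordell–Weil rank `rank_ℤ E(ℚ)` is invariant under an admissible change of variables
`C` (Silverman AEC III.3.1(b): `C` induces a group isomorphism on rational points; tree lemma
`WeierstrassCurve.VariableChange.finrank_point_variableChange`). -/
theorem leadingTerm_mordellWeilRank_smul (W : WeierstrassCurve ℚ)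
    (C : WeierstrassCurve.VariableChange ℚ) :
    (C • W).mordellWeilRank = W.mordellWeilRank :=
  @WeierstrassCurve.VariableChange.finrank_point_variableChange ℚ _ W C (Classical.decEq ℚ)

/-- (T2) The local Euler factor of an elliptic curve over the fraction field `K` of a discrete
valuation ring `R` — read off a minimal model over `R` (reduction type and number of points of the
reduction) — is invariant under a change of variables over `K`: the minimal models of `W` and `C • W`
differ by an `R`-integral isomorphism, which preserves the valuation of the minimal discriminant, the
reduction type and the point count of the reduction. -/
theorem leadingTerm_localEulerFactor_smul (R : Type) [CommRing R] [IsDomain R]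
    [IsDiscreteValuationRing R] (K : Type) [Field K] [Algebra R K] [IsFractionRing R K]
    (W : WeierstrassCurve K) [W.IsElliptic] (C : WeierstrassCurve.VariableChange K) :
    (C • W).localEulerFactor R = W.localEulerFactor R := by
  obtain ⟨D, hD⟩ : ∃ D : WeierstrassCurve.VariableChange K,
      (C • W).minimal R = D • W.minimal R :=
    ⟨((C • W).exists_isMinimal R).choose * C * ((W.exists_isMinimal R).choose)⁻¹, by
      rw [WeierstrassCurve.minimal, WeierstrassCurve.minimal, mul_smul, mul_smul, inv_smul_smul]⟩
  haveI hE : (W.minimal R).IsElliptic := by rw [WeierstrassCurve.minimal]; infer_instance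
  have hΔ : (W.minimal R).Δ ≠ 0 := (W.minimal R).isUnit_Δ.ne_zero
  have hgood : ((C • W).minimal R).HasGoodReduction R ↔ (W.minimal R).HasGoodReduction R := by
    rw [WeierstrassCurve.hasGoodReduction_iff, WeierstrassCurve.hasGoodReduction_iff,
      WeierstrassCurve.valuation_Δ_eq_of_isMinimal_of_eq_smul R hD]
    exact and_congr_left' ⟨fun _ => inferInstance, fun _ => inferInstance⟩
  have hcard : Nat.card (((C • W).minimal R).reduction R).toAffine.Point =
      Nat.card ((W.minimal R).reduction R).toAffine.Point := by
    obtain ⟨E, hE⟩ := WeierstrassCurve.exists_reduction_eq_smul R hD hΔ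
    rw [hE]
    exact WeierstrassCurve.natCard_point_smul _ _
  have hpoly : (C • W).localPolynomial R = W.localPolynomial R := by
    classical
    unfold WeierstrassCurve.localPolynomial
    simp only [hgood, hcard,
      WeierstrassCurve.hasSplitMultiplicativeReduction_iff_of_isMinimal_of_eq_smul R hD hΔ,
      WeierstrassCurve.hasMultiplicativeReduction_iff_of_isMinimal_of_eq_smul R hD hΔ]
  simp only [WeierstrassCurve.localEulerFactor, WeierstrassCurve.localPowerSeries, hpoly]

/-- (T3) The entire L-function `Λ`-normalised `L(E,s)` of an elliptic curve over `ℚ` (the tree's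
`WeierstrassCurve.entireLFunction`: the Euler product over the local factors at every prime, its
`LSeries` and its chosen entire continuation) is invariant under a change of variables over `ℚ`,
because every local Euler factor is (`leadingTerm_localEulerFactor_smul` over each `ℤ_[p] ⊂ ℚ_[p]`). -/
theorem leadingTerm_entireLFunction_smul (W : WeierstrassCurve ℚ) [W.IsElliptic]
    (C : WeierstrassCurve.VariableChange ℚ) :
    (C • W).entireLFunction = W.entireLFunction := by
  have hL : (C • W).LFunction = W.LFunction := by
    unfold WeierstrassCurve.LFunction
    congr 1
    funext v
    simp only [WeierstrassCurve.baseChange, ← WeierstrassCurve.map_variableChange]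
    exact leadingTerm_localEulerFactor_smul _ _ _ _
  have hLS : (C • W).LSeries = W.LSeries := by
    funext s
    simp only [WeierstrassCurve.LSeries, hL]
  have hEC : (C • W).entireContinuations = W.entireContinuations := by
    simp only [WeierstrassCurve.entireContinuations, hLS]
  unfold WeierstrassCurve.entireLFunction
  rw [hEC, hLS]

/-- `log_p γ_cyc ≠ 0`: the Iwasawa branch of the `p`-adic logarithm vanishes exactly on
`p^ℤ · μ(ℚ_p)` (`padicLog_eq_zero_iff_holds`), while the topological generator
`γ_cyc = 1 + p^e` (`e = 1` for odd `p`, `e = 2` for `p = 2`) is a natural number `≥ 2` prime to `p`,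
so no power of it is a power of `p` (same argument as in `Literature.Barriers.BirchSwinnertonDyer.
ExceptionalZero`, inlined to keep the route's import cone). -/
theorem leadingTerm_padicLog_cyclotomicGenerator_ne_zero (p : ℕ) [Fact p.Prime] :
    Literature.NumberTheory.EllipticCurves.padicLog p
      (Literature.NumberTheory.EllipticCurves.cyclotomicGenerator p : ℚ_[p]) ≠ 0 := by
  have hpp : p.Prime := Fact.out
  have hp0 : (p : ℚ_[p]) ≠ 0 := by exact_mod_cast hpp.ne_zero
  have h2 : 2 ≤ Literature.NumberTheory.EllipticCurves.cyclotomicGenerator p := by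
    have := Nat.one_le_pow (Literature.NumberTheory.EllipticCurves.cyclotomicExponent p) p hpp.pos
    unfold Literature.NumberTheory.EllipticCurves.cyclotomicGenerator; omega
  have hγ0 : Literature.NumberTheory.EllipticCurves.cyclotomicGenerator p ≠ 0 := by omega
  have hγ : ((Literature.NumberTheory.EllipticCurves.cyclotomicGenerator p : ℕ) : ℚ_[p]) ≠ 0 := by
    exact_mod_cast hγ0
  have hdvd : ¬ p ∣ Literature.NumberTheory.EllipticCurves.cyclotomicGenerator p := by
    intro h
    have he : Literature.NumberTheory.EllipticCurves.cyclotomicExponent p ≠ 0 := by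
      unfold Literature.NumberTheory.EllipticCurves.cyclotomicExponent; split_ifs <;> omega
    have h' : p ∣ p ^ Literature.NumberTheory.EllipticCurves.cyclotomicExponent p :=
      dvd_pow_self p he
    have h1 : p ∣ 1 := by
      have := Nat.dvd_sub h h'
      simpa [Literature.NumberTheory.EllipticCurves.cyclotomicGenerator] using this
    exact hpp.one_lt.ne' (Nat.dvd_one.mp h1)
  intro h0
  obtain ⟨n, k, hk, h⟩ :=
    (Literature.NumberTheory.EllipticCurves.padicLog_eq_zero_iff_holds (p := p) hγ).mp h0
  obtain ⟨m, rfl | rfl⟩ := Int.eq_nat_or_neg n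
  · rw [zpow_neg, zpow_natCast, mul_pow, inv_pow,
      mul_inv_eq_one₀ (pow_ne_zero _ (pow_ne_zero _ hp0))] at h
    have h' : Literature.NumberTheory.EllipticCurves.cyclotomicGenerator p ^ k = (p ^ m) ^ k := by
      exact_mod_cast h
    rcases Nat.eq_zero_or_pos m with rfl | hm
    · rw [pow_zero, one_pow, Nat.pow_eq_one] at h'
      omega
    · have : p ∣ Literature.NumberTheory.EllipticCurves.cyclotomicGenerator p := by
        apply hpp.dvd_of_dvd_pow (n := k)
        rw [h']
        exact dvd_pow (dvd_pow_self p hm.ne') hk.ne'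
      exact hdvd this
  · rw [neg_neg, zpow_natCast] at h
    have h' : (Literature.NumberTheory.EllipticCurves.cyclotomicGenerator p * p ^ m) ^ k = 1 := by
      exact_mod_cast h
    rw [Nat.pow_eq_one] at h'
    rcases h' with h' | h'
    · have := Nat.eq_one_of_mul_eq_one_right h'
      omega
    · omega

/-- `LB_∞` on a globally minimal model. `PinchPrime` supplies a good ordinary prime `p ≥ 5`, the
canonical cyclotomic `p`-adic height datum `D` at `p` and the newform `f` of `E` with
`ord_{T=0} L_p(f, α_p, T) = r := rank_ℤ E(ℚ)`; hence `[T^r] L_p ≠ 0` (`PowerSeries.order_eq_nat`),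
and with `log_p γ_cyc ≠ 0` the `p`-adic identity of `Consistency`,
`[T^r] L_p · log_p(γ_cyc)^r = q · (1 − α_p⁻¹)² · Reg_p(E,D)`, forces `q ≠ 0`; then the archimedean
identity `L^(r)(E,1) = r! · q · Ω⁺_f · Reg_∞(E)` with `Ω⁺_f > 0` and `Reg_∞(E) > 0` (the
well-definedness conjuncts of `Consistency`) gives `L^(r)(E,1) ≠ 0`. -/
theorem leadingTerm_iteratedDeriv_ne_zero_of_isGloballyMinimal (hC : Consistency) (hP : PinchPrime)
    (W : WeierstrassCurve ℚ) [W.IsElliptic] [W.IsGloballyMinimal] :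
    iteratedDeriv W.mordellWeilRank W.entireLFunction 1 ≠ 0 := by
  obtain ⟨p, hp, h5, hord, D, hD, N, hN, f, hf, horder⟩ := hP W
  haveI : Fact p.Prime := hp
  haveI : NeZero N := hN
  obtain ⟨hreg, hΩ, q, harch, hpad⟩ := hC W p h5 hord D hD f hf
  -- the coefficient of `T^{r_MW}` is the leading one, hence non-zero
  have hcoeff : PowerSeries.coeff W.mordellWeilRank
      (Literature.NumberTheory.EllipticCurves.padicLFunction f
        (Literature.NumberTheory.EllipticCurves.unitRoot W p : ℚ_[p])) ≠ 0 :=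
    (PowerSeries.order_eq_nat.mp horder).1
  have hlog := leadingTerm_padicLog_cyclotomicGenerator_ne_zero p
  -- hence the rational number `q` of `Consistency` is non-zero
  have hq : q ≠ 0 := by
    rintro rfl
    have h0 : PowerSeries.coeff W.mordellWeilRank
        (Literature.NumberTheory.EllipticCurves.padicLFunction f
          (Literature.NumberTheory.EllipticCurves.unitRoot W p : ℚ_[p])) *
        Literature.NumberTheory.EllipticCurves.padicLog p
          (Literature.NumberTheory.EllipticCurves.cyclotomicGenerator p) ^ W.mordellWeilRank = 0 := by
      rw [hpad]; push_cast; ring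
    exact (mul_ne_zero hcoeff (pow_ne_zero _ hlog)) h0
  -- and the archimedean side `r! · q · Ω⁺_f · Reg_∞` is non-zero
  rw [harch]
  have h1 : (0 : ℝ) < W.mordellWeilRank.factorial := by exact_mod_cast Nat.factorial_pos _
  have hq' : (q : ℝ) ≠ 0 := by exact_mod_cast hq
  have : (W.mordellWeilRank.factorial : ℝ) * (q : ℝ) *
      Literature.NumberTheory.EllipticCurves.ModularForms.plusPeriod f * W.regulator ≠ 0 :=
    mul_ne_zero (mul_ne_zero (mul_ne_zero h1.ne' hq') hΩ.ne') hreg.ne'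
  exact_mod_cast this

/-- The support item `LBOfCruxes` of route LeadingTerm (stmt-BirchSwinnertonDyer-15623): the cruxes
`Consistency` (leading-term consistency of the archimedean and `p`-adic BSD quotients at the
algebraic rank, with `Reg_∞ > 0` and `Ω⁺_f > 0`) and `PinchPrime` (one good ordinary prime `p ≥ 5`,
with its canonical cyclotomic height datum and the newform of `E`, at which
`ord_T L_p(f, α_p, T) = rank_ℤ E(ℚ)`) imply the archimedean lower bound `LB_∞`: for every elliptic
curve `E/ℚ` the `rank_ℤ E(ℚ)`-th Taylor coefficient of `L(E,s)` at `s = 1` is non-zero. Proof: pass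
to a global minimal model `C • W` (`hasGlobalMinimalModel_rat_holds`), apply
`leadingTerm_iteratedDeriv_ne_zero_of_isGloballyMinimal`, and transport back along `C` by the
invariance of the Mordell–Weil rank and of the entire L-function. -/
theorem leadingTerm_lbOfCruxes_proof :
    Summit.BirchSwinnertonDyer.BirchSwinnertonDyer.Theses.LeadingTerm.LBOfCruxes := by
  unfold Summit.BirchSwinnertonDyer.BirchSwinnertonDyer.Theses.LeadingTerm.LBOfCruxes
  intro hC hP W hW
  haveI : W.IsElliptic := hW
  -- pass to a global minimal model and apply the lower bound there
  obtain ⟨C, hCmin⟩ := WeierstrassCurve.hasGlobalMinimalModel_rat_holds W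
  haveI : (C • W).IsGloballyMinimal := hCmin
  rw [← leadingTerm_mordellWeilRank_smul W C, ← leadingTerm_entireLFunction_smul W C]
  exact leadingTerm_iteratedDeriv_ne_zero_of_isGloballyMinimal hC hP (C • W)

end Summit.BirchSwinnertonDyer.BirchSwinnertonDyer.Theorems
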